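import Summits.Ventures.PercRepro.SixFourPLProfileB

/-!
# PercRepro — C-025 at `(6,4)`: the size facts of a plane-line normalisation with the cap `K` as a parameter
(p2, gen 8; the `K`-forms of `three_le_card_L`, `card_lam_add_card_L_le`, `card_ellF_inter_G_le_six`, `size_facts`
of `SixFourPLNorm` / `SixFourPLProfile` / `SixFourPLProfileB` — §21.18.9.1).
-/

namespace PercRepro.SixFour

open Finset ThmH

variable {α : Type*} [DecidableEq α] {M : Matroid α} [M.Finite] {G : Finset α}

namespace PLData

variable {D : PLData M G}

/-- `g(profile D) = |G|`. -/
theorem g_profile_eq : PL.g D.profile = G.card := D.card_ρ_add_card_L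

/-- With the plane trace `≤ K` and `g ≥ K + 3`, the rest has `n ≥ 3` points. -/
theorem three_le_card_L_K {K : ℕ} (hpl : (D.P₀ ∩ G).card ≤ K) (hg : K + 3 ≤ G.card) : 3 ≤ D.L.card := by
  have := D.card_ρ_add_card_L
  unfold ρ at this
  omega

/-- `λ_y` and `L` are disjoint subsets of `Π_y ∩ G`: `|λ_y| + n ≤ K`. -/
theorem card_lam_add_card_L_le_K (hs : Simple M) (hG : G ⊆ gr M) (h2 : 2 ≤ D.L.card) {K : ℕ}
    (hpl : ∀ P ∈ planes M, (P ∩ G).card ≤ K) {y : α} (hy : y ∈ D.ρ \ D.ellF) :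
    (D.lam y).card + D.L.card ≤ K := by
  rw [Finset.mem_sdiff] at hy
  have hyG := D.ρ_subset hy.1
  have hPi := Pi_mem_planes hs hG h2 hyG hy.2
  have hsub : D.lam y ∪ D.L ⊆ D.Pi y ∩ G := by
    intro z hz
    rw [Finset.mem_union] at hz
    rw [Finset.mem_inter]
    rcases hz with hz | hz
    · unfold lam at hz
      rw [Finset.mem_inter] at hz
      exact ⟨hz.1, D.ρ_subset hz.2⟩
    · exact ⟨hPi.2 (Finset.mem_insert_of_mem hz), D.L_subset hz⟩
  have hdisj : Disjoint (D.lam y) D.L := by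
    rw [Finset.disjoint_left]
    intro z hz hzL
    unfold lam ρ at hz
    unfold L at hzL
    exact (Finset.mem_sdiff.1 hzL).2 (Finset.mem_inter.1 (Finset.mem_inter.1 hz).2).1
  have := (Finset.card_le_card hsub).trans (hpl _ hPi.1)
  rw [Finset.card_union_of_disjoint hdisj] at this
  exact this

/-- `|ℓ ∩ G| + 1 ≤ K` (22.12.2 (d)): a plane `Π_y`, `y ∈ ρ ∖ ℓ`, contains `(ℓ ∩ G) ∪ {y}`. -/
theorem card_ellF_inter_G_add_one_le_K (hs : Simple M) (hG : G ⊆ gr M) (h2 : 2 ≤ D.L.card) {K : ℕ}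
    (hpl : ∀ P ∈ planes M, (P ∩ G).card ≤ K) : (D.ellF ∩ G).card + 1 ≤ K := by
  obtain ⟨y, hy⟩ := ρ_sdiff_ellF_nonempty (D := D) hs hG h2
  rw [Finset.mem_sdiff] at hy
  have hyG : y ∈ G := D.ρ_subset hy.1
  have hPi := Pi_mem_planes hs hG h2 hyG hy.2
  have hsub : insert y (D.ellF ∩ G) ⊆ D.Pi y ∩ G := by
    intro z hz
    rw [Finset.mem_insert] at hz
    rw [Finset.mem_inter]
    rcases hz with rfl | hz
    · exact ⟨hPi.2 (Finset.mem_insert_self _ _), hyG⟩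
    · rw [Finset.mem_inter] at hz
      exact ⟨ellF_subset_Pi y hz.1, hz.2⟩
  have hyℓ : y ∉ D.ellF ∩ G := fun h => hy.2 (Finset.mem_inter.1 h).1
  have h := (Finset.card_le_card hsub).trans (hpl _ hPi.1)
  rw [Finset.card_insert_of_notMem hyℓ] at h
  exact h

/-- **The size facts with the cap `K` and `g = K + 3`** (§21.18.9.1): `n + e + 1 ≤ K`, `4 ≤ p ≤ K`, `3 ≤ n`. -/
theorem size_facts_K (hs : Simple M) (hG : G ⊆ gr M) {K : ℕ} (hpl : ∀ P ∈ planes M, (P ∩ G).card ≤ K)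
    (hg : G.card = K + 3) :
    D.L.card + (D.ellF ∩ D.ρ).card + 1 ≤ K ∧ 4 ≤ D.ρ.card ∧ D.ρ.card ≤ K ∧ 3 ≤ D.L.card := by
  have hpK : D.ρ.card ≤ K := hpl _ D.plane
  have h3 := D.three_le_card_L_K hpK (by omega)
  have hK := card_ellF_inter_G_add_one_le_K (D := D) hs hG (by omega) hpl
  rw [card_ellF_inter_G (D := D) hs hG (by omega)] at hK
  have hsum := D.card_ρ_add_card_L
  exact ⟨hK, by omega, hpK, h3⟩

/-- The facts used by the steps of Theorem 22.12 at the cap `g − 3` with `7 ≤ g ≤ 10`: `2 ≤ n`, `3 ≤ n`,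
`n + e ≤ 6`, `p ≤ 7`, every plane trace `≤ 7`, every class size `≤ 7 − n`. -/
theorem steps_facts (hs : Simple M) (hG : G ⊆ gr M) (hpl : ∀ P ∈ planes M, (P ∩ G).card + 3 ≤ G.card)
    (hg : 7 ≤ G.card) (hg10 : G.card ≤ 10) :
    2 ≤ D.L.card ∧ 3 ≤ D.L.card ∧ D.L.card + (D.ellF ∩ D.ρ).card ≤ 6 ∧ D.ρ.card ≤ 7 ∧
      (∀ P ∈ planes M, (P ∩ G).card ≤ 7) ∧ (∀ s ∈ D.sizes, s ≤ 7 - D.L.card) := by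
  have hplK : ∀ P ∈ planes M, (P ∩ G).card ≤ G.card - 3 := fun P hP => by have := hpl P hP; omega
  obtain ⟨hne, -, hpK, hn3⟩ := size_facts_K (D := D) hs hG hplK (by omega)
  refine ⟨by omega, hn3, by omega, by omega, fun P hP => by have := hpl P hP; omega, ?_⟩
  intro s hs'
  obtain ⟨y, hy, rfl⟩ := mem_sizes.1 hs'
  have := card_lam_add_card_L_le_K hs hG (by omega) hplK hy
  omega

end PLData

end PercRepro.SixFour
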